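import Summits.Parity.GeneralizedHardyLittlewood.Theorems.BeyondDiagonalBeatsQuarter.OffDiagPrincipalLevelScales
import HarnessLib

/-!
# Route `PrimeLevelFamEdge`, crux K_B (stmt-Parity-20343), line `diagonal_kernel_split` rev 4, plan Ω,
# `OffDiagCoreTallCount` stage 2d′: **the `ms`-currency bound of the principal piece under a height bound ON THE RANGES
# ONLY** (`Hf q d₁ d₂ (l/d₁) (m/d₂) (r+1) i ≤ q^{A₀}` for `r < q⁷`, `l, m ≤ ⌊q̂^{Δ′}⌋`, `d₁ ∣ l`, `d₂ ∣ m`, `i` near)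

`OffDiagPrincipalLevelScales.abs_levelBody_principal_scales_le` asks `Hf q d₁ d₂ a b c i ≤ q^{A₀}` for ALL arguments, which a
genuine height function (K1's `⌈q·c·D₁·q^{ε₀}/(2π)⌉`, growing with `c` and `αβ`) does not satisfy. Only the cells of the
level body matter: replacing `Hf` by `min Hf q^{A₀}` does not change `levelBody q Δ′ (switchedCell K Hf q)` when `Hf ≤ q^{A₀}`
on the ranges (`switchedCell_height_congr`, `levelBody_congr`), and the capped height satisfies the global hypothesis.

* `switchedCell_height_congr` — the switched cell at `(r,l,m,d₁,d₂,i)` sees `Hf` only through `Hf q d₁ d₂ (l/d₁) (m/d₂) (r+1) i`;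
* **`abs_levelBody_principal_scales_le_of_ranges`**, **`abs_coreP_scales_le_of_ranges`** — the stage 2d bounds under the
  ranged height hypothesis.
Bounds only; no def; helper toward `stub_offDiagBelowSlack_io` (`--supports stmt-Parity-20343`); closes nothing;
standard axioms.
«The programme SEARCHES and TYPES; no claim about Landau–Siegel zeros, Theorems 1–2 of arXiv:2211.02515 or
a repaired Margin232 until a kernel theorem says so.»
-/

noncomputable section

open Real Finset Polynomial
open scoped Real

namespace Summit.Parity.GeneralizedHardyLittlewood.Theorems.BeyondDiagonalBeatsQuarter.OffDiag

open Literature.NumberTheory.LFunctions Literature.NumberTheory.LFunctions.KMV2000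
open PeterssonSplit (nearBoxes)

/-- **The switched cell sees the height function only at its own cell**: if two height functions agree at
`(q, d₁, d₂, l/d₁, m/d₂, r+1, i)`, the switched cells at `(r, l, m, d₁, d₂, i)` agree (any kernel `K`). [folklore] -/
theorem switchedCell_height_congr (K : ℕ → ℤ → ℤ → ℤ → ℕ → ℂ)
    {Hf Hf' : ℕ → ℕ → ℕ → ℕ → ℕ → ℕ → ℕ × ℕ → ℕ} {q r l m d₁ d₂ : ℕ} {i : ℕ × ℕ}
    (h : Hf q d₁ d₂ (l / d₁) (m / d₂) (r + 1) i = Hf' q d₁ d₂ (l / d₁) (m / d₂) (r + 1) i) :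
    switchedCell K Hf q r l m d₁ d₂ i = switchedCell K Hf' q r l m d₁ d₂ i := by
  unfold switchedCell
  rw [h]

/-- **The principal piece of one level in `ms`-currency, height bound on the ranges only.** For `q ≥ 40`,
`1 < Δ′ ≤ 2`, a height function with `Hf q d₁ d₂ (l/d₁) (m/d₂) (r+1) i ≤ q^{A₀}` whenever `r < q⁷`, `l, m ∈ [1, ⌊q̂^{Δ′}⌋]`,
`d₁ ∣ l`, `d₂ ∣ m`, `i ∈ nearBoxes q d₁ d₂ (log q)⁴`, and `τ(n) ≤ C·n^δ` (`0 ≤ δ < 1/4`):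
`|levelBody q Δ′ (switchedCell K_P Hf q)| ≤ 31000·(1+A₀)⁴·C⁴·(log q)^{11}·q̂^{Δ′−1+8δ}·mainScaleReal Δ′ q`.
[cite: KowalskiMichelVanderKam2000, §6 p. 19, (21)–(23) p. 12 — derivation] -/
theorem abs_levelBody_principal_scales_le_of_ranges {q : ℕ} [NeZero q] (hq : 40 ≤ q) {Δ' : ℝ} (h1 : 1 < Δ')
    (h2 : Δ' ≤ 2) {A₀ : ℕ} (Hf : ℕ → ℕ → ℕ → ℕ → ℕ → ℕ → ℕ × ℕ → ℕ)
    (hHf : ∀ r ∈ Finset.range (q ^ 7), ∀ l ∈ Icc 1 ⌊qhat q ^ Δ'⌋₊, ∀ m ∈ Icc 1 ⌊qhat q ^ Δ'⌋₊,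
      ∀ d₁ ∈ l.divisors, ∀ d₂ ∈ m.divisors, ∀ i ∈ nearBoxes q d₁ d₂ (Real.log q ^ 4),
        Hf q d₁ d₂ (l / d₁) (m / d₂) (r + 1) i ≤ q ^ A₀)
    {C δ : ℝ} (hδ0 : 0 ≤ δ) (hδ : δ < 1 / 4) (hC : ∀ n : ℕ, ((n.divisors.card : ℕ) : ℝ) ≤ C * (n : ℝ) ^ δ) :
    |levelBody q Δ' (switchedCell (fun c _ s h₁ q ↦ levelPrincipal {q} (fun _ ↦ (1 : ℂ)) (switchMod c s h₁)) Hf q)| ≤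
      31000 * (1 + (A₀ : ℝ)) ^ 4 * C ^ 4 * Real.log q ^ 11 * qhat q ^ (Δ' - 1 + 8 * δ) *
        mainScaleReal Δ' q := by
  -- cap the height function
  set Hf' : ℕ → ℕ → ℕ → ℕ → ℕ → ℕ → ℕ × ℕ → ℕ :=
    fun q' d₁ d₂ a b c i ↦ min (Hf q' d₁ d₂ a b c i) (q' ^ A₀) with hHf'
  have hcap : ∀ d₁ d₂ a b c i, Hf' q d₁ d₂ a b c i ≤ q ^ A₀ := fun _ _ _ _ _ _ ↦ min_le_right _ _
  have hbody : levelBody q Δ'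
      (switchedCell (fun c _ s h₁ q ↦ levelPrincipal {q} (fun _ ↦ (1 : ℂ)) (switchMod c s h₁)) Hf q) =
      levelBody q Δ'
        (switchedCell (fun c _ s h₁ q ↦ levelPrincipal {q} (fun _ ↦ (1 : ℂ)) (switchMod c s h₁)) Hf' q) := by
    refine levelBody_congr q Δ' fun r hr l hl m hm d₁ hd₁ d₂ hd₂ i hi ↦ switchedCell_height_congr _ ?_
    simp only [hHf']
    exact (min_eq_left (hHf r hr l hl m hm d₁ hd₁ d₂ hd₂ i hi)).symm
  rw [hbody]
  exact abs_levelBody_principal_scales_le hq h1 h2 Hf' hcap hδ0 hδ hC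

/-- **`coreP` over a block in `ms`-currency, height bound on the ranges only**: as `abs_coreP_scales_le`, with the
height hypothesis required only on the cells of each level body. [cite: KowalskiMichelVanderKam2000, §6 p. 19 — derivation] -/
theorem abs_coreP_scales_le_of_ranges (G : Finset ℕ) (hG : ∀ q ∈ G, 40 ≤ q) {Δ' : ℝ} (h1 : 1 < Δ') (h2 : Δ' ≤ 2)
    {A₀ : ℕ} (Hf : ℕ → ℕ → ℕ → ℕ → ℕ → ℕ → ℕ × ℕ → ℕ)
    (hHf : ∀ q ∈ G, ∀ r ∈ Finset.range (q ^ 7), ∀ l ∈ Icc 1 ⌊qhat q ^ Δ'⌋₊, ∀ m ∈ Icc 1 ⌊qhat q ^ Δ'⌋₊,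
      ∀ d₁ ∈ l.divisors, ∀ d₂ ∈ m.divisors, ∀ i ∈ nearBoxes q d₁ d₂ (Real.log q ^ 4),
        Hf q d₁ d₂ (l / d₁) (m / d₂) (r + 1) i ≤ q ^ A₀)
    {C δ : ℝ} (hδ0 : 0 ≤ δ) (hδ : δ < 1 / 4) (hC : ∀ n : ℕ, ((n.divisors.card : ℕ) : ℝ) ≤ C * (n : ℝ) ^ δ) :
    |coreP G Hf Δ'| ≤ ∑ q ∈ G, 31000 * (1 + (A₀ : ℝ)) ^ 4 * C ^ 4 * Real.log q ^ 11 *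
      qhat q ^ (Δ' - 1 + 8 * δ) * mainScaleReal Δ' q := by
  refine abs_coreP_le_sum G (fun q hq ↦ by have := hG q hq; omega) Hf Δ' _ fun q hq _ ↦ ?_
  exact abs_levelBody_principal_scales_le_of_ranges (hG q hq) h1 h2 Hf (hHf q hq) hδ0 hδ hC

end Summit.Parity.GeneralizedHardyLittlewood.Theorems.BeyondDiagonalBeatsQuarter.OffDiag
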